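import Summits.BirchSwinnertonDyer.BirchSwinnertonDyer.Theorems.ByReductionTypeAtTwoRankOneAtTwoBigImageOddLocalOneDoorBottomFrame
import Summits.BirchSwinnertonDyer.BirchSwinnertonDyer.Theorems.ByReductionTypeAtTwoRankOneAtTwoBigImageOddLocalOneDoorBottomAssemblyNeg
import Summits.BirchSwinnertonDyer.BirchSwinnertonDyer.Theorems.ByReductionTypeAtTwoRankOneAtTwoBigImageOddLocalOneDoorBottomFirstLayerNeg
import Summits.BirchSwinnertonDyer.BirchSwinnertonDyer.Theorems.ByReductionTypeAtTwoRankOneAtTwoBigImageOddLocalOneDoorBottomFirstLayerPos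
import Summits.BirchSwinnertonDyer.BirchSwinnertonDyer.Theorems.ByReductionTypeAtTwoRankOneAtTwoBigImageOddLocalOneDoorBottomLeavesLines
import Summits.BirchSwinnertonDyer.BirchSwinnertonDyer.Theorems.GenusKolyvaginAtTwoGenusPrimitiveSupplyAtTwoPrimeHeegnerTwinUnramified
import Literature.NumberTheory.QuadraticForms.PadicHilbertSymbol
import Literature.NumberTheory.EllipticCurves.MatsunoTwistedCurvesLocalProofs
import HarnessLib

/-!
# Route ByReductionTypeAtTwo, crux `RankOneAtTwoBigImageOddLocal` (stmt-BirchSwinnertonDyer-23715), LINE v8.12 `one_door_analytic`: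
# the bottom-rung frame WITHOUT CASSELS–TATE — `FirstDescentLeavesAtTwoBottom ⟹ U₀` modulo the four primary printed facts only

Width prover seat `bsd-line-fkl-p2` g12 (2026-08-28), `--supports stmt-BirchSwinnertonDyer-23715` (helper).  THEOREMS ONLY (no definition,
no named fact, no `sorry`).  BSD is not proved by any of this.

The lead's frame `doorIndexLawUpperCAtTwoBottom_of_leaves` (`Theorems/…OneDoorBottomFrame.lean`) closes the bottom rung U₀
(`DoorIndexLawUpperCAtTwoBottom`) from the input record `FirstDescentInput W Wd`, the four primary printed facts (Gross–Zagier, Kolyvagin,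
modularity, Hoffstein–Luo) AND the Cassels–Tate pairing (`exists_casselsTate_pairing`, skeleton stub `stub_pubCT`), the latter used at ONE
point: the parity input `heven` of the twin half `twinSel_eq_bot₂` («a non-zero class of `Sel₂(Wd/ℚ)` is never alone», `twin_selmerTwo_even_at`).

This file removes that input.  The twin engine minus parity already gives `#Sel₂(Wd/ℚ) ≤ 2` (§1: all non-zero twin Selmer classes have the
same, non-zero, localisation at the error place, so they coincide), the E-side engine gives `#Sel₂(W/ℚ) = 2`, and the DIRECTION of
Mazur–Rubin's Cor. 3.4 (i) at the door's ONE error place decides between `#Sel₂(Wd) ∈ {1, 4}`: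

* §2 `door_place_menu₅` — at a door-admissible `d` every finite place of `ℚ` away from the transposition primes is on route GenusKolyvaginAtTwo's
  five-row menu for the pair `(W, C • W^{(d)})`: split over `2` (`d ≡ 1 (mod 8)`) and over the odd bad primes (`(d/ℓ) = 1`), silent for both
  curves over the `3`-cycle primes of `d` (`#W(ℚ_v)[2] = #Wd(ℚ_v)[2] = 1`), good for both elsewhere;
* §3 `selmerGroup_twin_eq_bot_of_neg` — `Δ_W < 0`, minimal door (`t = 1`, `s = 0`): `T = {q₀}` the transposition prime (odd, good, ramified,
  `#W(ℚ_{q₀})[2] = 2`), the real place has `H¹ = 0` for both; gk2-p4/p5's UNCONDITIONAL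
  `GenusKolyTwistLocal.natCard_selmerGroup_twist_directed_of_menu₅_frame`: strict ⟹ `#Sel₂(Wd) = 2·#Sel₂(W) = 4` (excluded by `≤ 2`), not strict
  ⟹ `2·#Sel₂(Wd) = #Sel₂(W) = 2`;
* §3 `selmerGroup_twin_eq_bot_of_pos` — `Δ_W > 0`, minimal door (`t = s = 0`): `T = {∞}` (`d < 0` is not a real square), every finite place on
  the menu; gk2-p5's UNCONDITIONAL `GenusKolyArch.natCard_selmerGroup_twist_shift_of_menu₅_inl` gives the same dichotomy;
* §4 `card_selmerTwo_of_input_ctFree`, **`doorIndexLawUpperCAtTwoBottom_of_leaves_ctFree`** — the lead's frame with the binder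
  `hCT : exists_casselsTate_pairing` DELETED: `GZ → Kolyvagin → exists_isNewformOf → HL → FirstDescentLeavesAtTwoBottom → DoorIndexLawUpperCAtTwoBottom`,
  and the `Δ_W < 0` corollary.

Inputs (all tree theorems): Poitou–Tate with real places (`poitouTate_selmerStructure_duality_real_holds`), Tate's local Euler characteristic
(`localEulerPoincareCharacteristic_holds`), Mazur–Rubin Lemmas 2.9–2.11 and Kramer's congruence for the framed canonical identification
`W^{(d)}[2] ≅ W[2]` (route GenusKolyvaginAtTwo, `GenusKolyTwistLocal` / `GenusKolyArch` / `GenusKolyKramer`), the door bookkeeping of this line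
(`exists_transpositionPrime`, `natCard_twoTorsion_eq_one_of_minimal`, `natCard_twoTorsion_eq_one_of_descMinimal`,
`natCard_ker_nsmul_adicCompletion_two_eq_two_of_jacobiSym`, `natCard_ker_nsmul_two_twist_adicCompletion_eq`).  Effect on the skeleton: `comp` may
call `doorIndexLawUpperCAtTwoBottom_of_leaves_ctFree h1.1 h1.2.1 h1.2.2.1 h1.2.2.2 hU0` and drop `stub_pubCT`.

References: [MazurRubin2010] Thm. 2.7, Lemmas 2.2, 2.9–2.11, Prop. 3.3, Cor. 3.4 (i); [Kramer1981] Thm. 1, Props. 3, 6, 7; [GrossLMS1991] §10;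
[Kolyvagin1989Izv] §3; [MilneADT2006] I Thm. 2.8, 4.10.
-/

set_option autoImplicit false
-- the Theorems namespace of this sub repeats the summit name by design (D-0017 nested layout)
set_option linter.dupNamespace false

noncomputable section

open scoped Classical

namespace Summit.BirchSwinnertonDyer.BirchSwinnertonDyer.Theorems.RankOneAtTwoOneDoor

open WeierstrassCurve NumberField IsDedekindDomain Rat.HeightOneSpectrum
  Literature.NumberTheory.EllipticCurves Literature.NumberTheory.EllipticCurves.ModularForms
  Literature.NumberTheory.GaloisRepresentations
  Summit.BirchSwinnertonDyer.Rank1Residual.F1Sign2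
  Summit.BirchSwinnertonDyer.Rank1Residual.F1Sign2.TranspositionDoor
  Summit.BirchSwinnertonDyer.BirchSwinnertonDyer.Theses.ByReductionTypeAtTwo
open Summit.BirchSwinnertonDyer.BirchSwinnertonDyer.Theorems.GenusExact.VisiblePairAtTwo
  (natCast_mem_primesEquiv_symm natGenerator_eq_of_natCast_prime_mem)

/-! ### §1 The twin engine minus parity: `#Sel₂(Wd/ℚ) ≤ 2` -/

section Abstract

variable {V₁ V₂ : Type*} [AddCommGroup V₁] [AddCommGroup V₂] {Pl : Type*}

/-- **Twin side, two-space form, WITHOUT the parity input: `#Sel₂ ≤ 2`.**  Hypotheses of `twinSel_eq_bot₂` minus `heven`: two non-zero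
classes of `Sel₂` both localise non-trivially at the error place `q₀` (`res_errorPlace_ne_zero_of_relaxed₂`), hence differ by a relaxed class
in `ker res_{q₀}` (`hline₂`, Mazur–Rubin Lemma 2.2 (i)), hence coincide (`eq_of_relaxed_of_sub_mem_errorKer₂`); so `Sel₂ ⊆ {0, s}` injects into
`Bool`. [cite: GrossLMS1991, §10] [cite: MazurRubin2010, Lemma 2.2 (i)] [cite: Kolyvagin1989Izv, §3] -/
theorem card_twinSel_le_two₂ (Loc₂ : Pl → AddSubgroup V₂) (q₀ : Pl) (A₂₀ : AddSubgroup V₂) (Kol : ℕ → Prop)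
    (pl : ℕ → Pl) (A₁ : ℕ → AddSubgroup V₁) (A₂ : ℕ → AddSubgroup V₂) (y : V₁) (c₂ : ℕ → V₂)
    (hc : ∀ ℓ, Kol ℓ → ∀ v, v ≠ pl ℓ → v ≠ q₀ → c₂ ℓ ∈ Loc₂ v)
    (hcℓ : ∀ ℓ, Kol ℓ → (c₂ ℓ ∈ Loc₂ (pl ℓ) ↔ y ∈ A₁ ℓ))
    (hrec : ∀ ℓ, Kol ℓ → ∀ d : V₂, (∀ v, v ≠ pl ℓ → v ≠ q₀ → d ∈ Loc₂ v) → d ∉ Loc₂ (pl ℓ) →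
      ∀ s : V₂, (∀ v, v ≠ q₀ → s ∈ Loc₂ v) → s ∉ A₂ ℓ → s ∉ A₂₀)
    (hceb : ∀ s : V₂, s ≠ 0 → (∀ v, v ≠ q₀ → s ∈ Loc₂ v) → ∃ ℓ, Kol ℓ ∧ s ∉ A₂ ℓ ∧ y ∉ A₁ ℓ)
    (hline₂ : ∀ s t : V₂, s ∈ Loc₂ q₀ → t ∈ Loc₂ q₀ → s ∉ A₂₀ → t ∉ A₂₀ → s - t ∈ A₂₀)
    (Sel₂ : AddSubgroup V₂) (hsel₂ : ∀ s, s ∈ Sel₂ ↔ ∀ v, s ∈ Loc₂ v) :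
    Nat.card Sel₂ ≤ 2 := by
  have hrel : ∀ {u : V₂}, u ∈ Sel₂ → ∀ v, v ≠ q₀ → u ∈ Loc₂ v := fun hu v _ => (hsel₂ _).mp hu v
  -- two non-zero Selmer classes coincide
  have key : ∀ s t : V₂, s ∈ Sel₂ → t ∈ Sel₂ → s ≠ 0 → t ≠ 0 → s = t := by
    intro s t hs ht hs0 ht0
    have hsA : s ∉ A₂₀ := res_errorPlace_ne_zero_of_relaxed₂ Loc₂ q₀ A₂₀ Kol pl A₁ A₂ y c₂ hc hcℓ hrec hceb (hrel hs) hs0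
    have htA : t ∉ A₂₀ := res_errorPlace_ne_zero_of_relaxed₂ Loc₂ q₀ A₂₀ Kol pl A₁ A₂ y c₂ hc hcℓ hrec hceb (hrel ht) ht0
    exact eq_of_relaxed_of_sub_mem_errorKer₂ Loc₂ q₀ A₂₀ Kol pl A₁ A₂ y c₂ hc hcℓ hrec hceb (hrel hs) (hrel ht)
      (hline₂ s t ((hsel₂ s).mp hs q₀) ((hsel₂ t).mp ht q₀) hsA htA)
  -- `Sel₂` injects into `Bool`
  let f : Sel₂ → Bool := fun x => decide (x.1 = 0)
  have hf : Function.Injective f := by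
    rintro ⟨s, hs⟩ ⟨t, ht⟩ hst
    by_cases hs0 : s = 0
    · by_cases ht0 : t = 0
      · exact Subtype.ext (hs0.trans ht0.symm)
      · simp [f, hs0, ht0] at hst
    · by_cases ht0 : t = 0
      · simp [f, hs0, ht0] at hst
      · exact Subtype.ext (key s t hs ht hs0 ht0)
  calc Nat.card Sel₂ ≤ Nat.card Bool := Nat.card_le_card_of_injective f hf
    _ = 2 := by simp

end Abstract

/-! ### §2 The five-row finite place menu at a door-admissible `d` -/

section Menu

variable (W : WeierstrassCurve ℚ) [W.IsElliptic] [W.IsGloballyMinimal]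

/-- **The five-row finite place menu at a door-admissible twist parameter.**  `W/ℚ` globally minimal elliptic, `d` door-admissible
(`DoorAdmissible W d`: `d < 0` squarefree, `d ≡ 1 (mod 8)`, the primes of `d` good, `(d/ℓ) = 1` at the odd bad primes), `Wd = C • W^{(d)}`, and a
finite place `v` of `ℚ` at which `W` is SILENT if `v ∣ d` (`#W(ℚ_v)[2] = 1` — the `3`-cycle primes of the door): then `v` is on route
GenusKolyvaginAtTwo's five-row menu for `(W, Wd)` — split over `2` (`d ≡ 1 (mod 8)` is a `2`-adic square) and over an odd bad prime (`(d/ℓ) = 1`),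
odd and silent for both over a prime of `d` (`#Wd(ℚ_v)[2] = #W(ℚ_v)[2]`, `natCard_ker_nsmul_two_twist_adicCompletion_eq`), odd and good for
both elsewhere (`hasGoodReductionAt_of_smul_quadraticTwist`).  Pattern of gk2-p4's `GenusKolyArch.descAdmissible_place_menu`.
[cite: MazurRubin2010, Lemma 2.10 (i), (ii) and Remark 2.4] [cite: Kramer1981, Prop. 3] [cite: Serre1973, Ch. II §3.3 Thm 3, Thm 4] -/
theorem door_place_menu₅ {d : ℤ} (hadm : DoorAdmissible W d) {Wd : WeierstrassCurve ℚ} [Wd.IsElliptic]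
    {C : VariableChange ℚ} (hC : C • W.quadraticTwist (d : ℚ) = Wd) (v : HeightOneSpectrum (𝓞 ℚ))
    (hsil : ((d : ℤ) : 𝓞 ℚ) ∈ v.asIdeal →
      Nat.card (nsmulAddMonoidHom 2 : (W.baseChange (v.adicCompletion ℚ)).toAffine.Point →+ _).ker = 1) :
    (∃ s : v.adicCompletion ℚ, s ^ 2 = algebraMap ℚ (v.adicCompletion ℚ) (d : ℚ)) ∨
      (((2 : ℕ) : 𝓞 ℚ) ∉ v.asIdeal ∧
        ¬ 2 ∣ (W.baseChange (v.adicCompletion ℚ)).localTamagawaNumber (v.adicCompletionIntegers ℚ) ∧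
        ¬ 2 ∣ (Wd.baseChange (v.adicCompletion ℚ)).localTamagawaNumber (v.adicCompletionIntegers ℚ)) ∨
      (((2 : ℕ) : 𝓞 ℚ) ∉ v.asIdeal ∧ W.HasGoodReductionAt v ∧ Wd.HasGoodReductionAt v) ∨
      (((2 : ℕ) : 𝓞 ℚ) ∉ v.asIdeal ∧
        Nat.card (nsmulAddMonoidHom 2 : (W.baseChange (v.adicCompletion ℚ)).toAffine.Point →+ _).ker = 1 ∧
        Nat.card (nsmulAddMonoidHom 2 : (Wd.baseChange (v.adicCompletion ℚ)).toAffine.Point →+ _).ker = 1) ∨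
      ((W.HasGoodReductionAt v ∨ (W.HasMultiplicativeReductionAt v ∧ Odd (W.ordMinimalDiscriminant v))) ∧
        closureEmb (K := ℚ) (v.adicCompletion ℚ) (geomSqrt (d : ℚ)) ∈
          IsNonarchimedeanLocalField.maxUnramified (v.adicCompletion ℚ)) := by
  obtain ⟨hdneg, -, hd8, hgoodd, hbad⟩ := hadm
  have hd0 : (d : ℚ) ≠ 0 := by exact_mod_cast hdneg.ne
  haveI := Fact.mk (primesEquiv v).2
  have hpP : (primesEquiv v : ℕ).Prime := (primesEquiv v).2
  have hpv : ((primesEquiv v : ℕ) : 𝓞 ℚ) ∈ v.asIdeal := Rat.HeightOneSpectrum.natCast_natGenerator_mem v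
  -- a `p`-adic square gives the split row
  have hsplit : IsSquare ((d : ℤ) : ℚ_[(primesEquiv v : ℕ)]) →
      ∃ s : v.adicCompletion ℚ, s ^ 2 = algebraMap ℚ (v.adicCompletion ℚ) (d : ℚ) := fun hsq => by
    have hsq' : IsSquare (((d : ℚ) : ℚ) : ℚ_[(primesEquiv v : ℕ)]) := by
      simpa only [Rat.cast_intCast] using hsq
    obtain ⟨s, hs⟩ := TwoDescentLocal.isSquare_algebraMap_adicCompletion_of_padic v hsq'
    exact ⟨s, by rw [sq]; exact hs.symm⟩
  by_cases hp2 : (primesEquiv v : ℕ) = 2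
  · -- over `2`: `d ≡ 1 (mod 8)` is a `2`-adic square
    exact Or.inl (hsplit (Literature.NumberTheory.QuadraticForms.padic_isSquare_intCast_of_mod_eight hp2 hd8))
  have h2v : ((2 : ℕ) : 𝓞 ℚ) ∉ v.asIdeal :=
    GenusKolyTwistingPrime.natCast_not_mem_of_not_dvd hpP hpv fun h =>
      hp2 ((Nat.prime_dvd_prime_iff_eq hpP Nat.prime_two).mp h)
  by_cases hpd : ((primesEquiv v : ℕ) : ℤ) ∣ d
  · -- over a prime of `d`: odd and silent for `W` (hypothesis), hence for `Wd`
    have hdv : ((d : ℤ) : 𝓞 ℚ) ∈ v.asIdeal :=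
      (Literature.NumberTheory.NumberFields.intCast_mem_asIdeal_iff_of_natCast_mem hpP v hpv d).mpr hpd
    have hker := hsil hdv
    refine Or.inr (Or.inr (Or.inr (Or.inl ⟨h2v, hker, ?_⟩)))
    rw [natCard_ker_nsmul_two_twist_adicCompletion_eq W hd0 hC v]
    exact hker
  by_cases hpN : (primesEquiv v : ℕ) ∣ W.conductorNorm ℤ
  · -- over an odd bad prime: `(d/p) = 1` makes `d` a `p`-adic square
    have hnotgood : ∀ _h : Fact (primesEquiv v : ℕ).Prime, ¬ W.HasGoodReductionAtPrime (primesEquiv v : ℕ) := fun _ hg =>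
      not_dvd_conductorNorm_of_hasGoodReductionAtPrime W hg hpN
    have hJ := hbad _ hpP hp2 hnotgood
    exact Or.inl (hsplit (padic_isSquare_of_jacobiSym_eq_one hp2 hJ))
  · -- over an odd good prime not dividing `d`: good for both
    have hW : W.HasGoodReductionAt v := by
      by_contra h
      exact hpN ((W.dvd_conductorNorm_iff v).mpr h)
    have hp2d : ¬ (((primesEquiv v : Nat.Primes) : ℕ) : ℤ) ∣ 2 * d := by
      intro h
      rcases (Nat.prime_iff_prime_int.mp hpP).dvd_or_dvd h with h2' | hd'
      · exact hp2 ((Nat.prime_dvd_prime_iff_eq hpP Nat.prime_two).mp (by exact_mod_cast h2'))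
      · exact hpd hd'
    exact Or.inr (Or.inr (Or.inl ⟨h2v, hW, GenusKolyTwistLocal.hasGoodReductionAt_of_smul_quadraticTwist W v hp2d hW hC⟩))

end Menu

/-! ### §3 The twin `2`-Selmer group vanishes at a minimal door: Cor. 3.4 (i) DIRECTED at the one error place -/

section Twin

variable (W : WeierstrassCurve ℚ) [W.IsElliptic] [W.IsGloballyMinimal]

/-- **`Sel₂(Wd/ℚ) = 0` at a minimal door with `Δ_W < 0`, WITHOUT Cassels–Tate.**  `W/ℚ` globally minimal elliptic with `Δ_W < 0`, `d`
door-admissible with `t(W, d) = 1`, `s(W, d) = 0`, `Wd = C • W^{(d)}` elliptic, `#Sel₂(W/ℚ) = 2` and `#Sel₂(Wd/ℚ) ≤ 2`: then `Sel₂(Wd/ℚ) = ⊥`.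
The one `T`-place is the transposition prime `q₀` of the door (odd, good, `v_{q₀}(d) = 1`, `#W(ℚ_{q₀})[2] = 2`); every other finite place is
on the five-row menu (`door_place_menu₅` with `natCard_twoTorsion_eq_one_of_minimal`), the real place has `H¹ = 0` for both curves
(`twist_place_menu_infinite_rat`); then `GenusKolyTwistLocal.natCard_selmerGroup_twist_directed_of_menu₅_frame` (Mazur–Rubin Cor. 3.4 (i) with
`T = {q₀}`, both directions, unconditional): `Sel₂(W)` strict at `q₀` would give `#Sel₂(Wd) = 4 > 2`, so it is not, and `2·#Sel₂(Wd) = 2`.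
[cite: MazurRubin2010, Prop. 3.3 and Cor. 3.4 (i)] [cite: Kramer1981, Prop. 3 and Thm. 1] [cite: GrossLMS1991, §10] -/
theorem selmerGroup_twin_eq_bot_of_neg {d : ℤ} (hadm : DoorAdmissible W d) (hΔ : W.Δ < 0)
    (ht : transpCount W d = 1) (hs : identCount W d = 0)
    (Wd : WeierstrassCurve ℚ) [Wd.IsElliptic] {C : VariableChange ℚ} (hC : C • W.quadraticTwist (d : ℚ) = Wd)
    (hW2 : Nat.card (selmerGroup W 2) = 2) (hWd2 : Nat.card (selmerGroup Wd 2) ≤ 2) :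
    selmerGroup Wd 2 = ⊥ := by
  have hdneg : d < 0 := hadm.1
  have hsq : Squarefree d := hadm.2.1
  have hd0 : (d : ℚ) ≠ 0 := by exact_mod_cast hdneg.ne
  -- the transposition prime `q₀` and its place `v₀`
  obtain ⟨q₀, hq₀p, hq₀d, hjac, hq₀2, hgood₀, hqΔ⟩ := exists_transpositionPrime W hadm ht
  haveI : Fact q₀.Prime := ⟨hq₀p⟩
  obtain ⟨v₀, hv₀⟩ : ∃ v : HeightOneSpectrum (𝓞 ℚ), ((primesEquiv v : Nat.Primes) : ℕ) = q₀ :=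
    ⟨primesEquiv.symm ⟨q₀, hq₀p⟩, by rw [Equiv.apply_symm_apply]⟩
  have hq₀v : (q₀ : 𝓞 ℚ) ∈ v₀.asIdeal := by
    rw [← hv₀]
    exact Rat.HeightOneSpectrum.natCast_natGenerator_mem v₀
  have hv₀' : v₀ = primesEquiv.symm ⟨q₀, hq₀p⟩ := by
    rw [Equiv.eq_symm_apply]
    exact Subtype.ext hv₀
  -- `v₀ ∤ 2`, `W` good at `v₀`
  have h2v₀ : ((2 : ℕ) : 𝓞 ℚ) ∉ v₀.asIdeal :=
    GenusKolyTwistingPrime.natCast_not_mem_of_not_dvd hq₀p hq₀v fun h =>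
      hq₀2 ((Nat.prime_dvd_prime_iff_eq hq₀p Nat.prime_two).mp h)
  have hv₀W : W.HasGoodReductionAt v₀ := by
    by_contra h
    exact not_dvd_conductorNorm_of_hasGoodReductionAtPrime W hgood₀ (hv₀ ▸ (W.dvd_conductorNorm_iff v₀).mpr h)
  -- `v₀(d) = 1`: `ι(√d) ∉ ℚ_{v₀}^{nr}`
  have hram : closureEmb (K := ℚ) (v₀.adicCompletion ℚ) (geomSqrt (d : ℚ)) ∉
      IsNonarchimedeanLocalField.maxUnramified (v₀.adicCompletion ℚ) := by
    apply GenusKolyTwistRamified.closureEmb_geomSqrt_not_mem_maxUnramified_rat v₀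
    -- `d = q₀ · m` with `q₀ ∤ m` (`d` squarefree), so `v₀(d) = v₀(q₀) · v₀(m) = exp(-1) · 1`
    obtain ⟨m, hm⟩ := id hq₀d
    have hqm : ¬ (q₀ : ℤ) ∣ m := by
      rintro ⟨k, hk⟩
      have hu : IsUnit (q₀ : ℤ) := hsq (q₀ : ℤ) ⟨k, by rw [hm, hk]; ring⟩
      have h2 : (2 : ℤ) ≤ q₀ := by exact_mod_cast hq₀p.two_le
      rcases Int.isUnit_iff.mp hu with h | h <;> omega
    have hmv : ((m : ℤ) : 𝓞 ℚ) ∉ v₀.asIdeal := fun h =>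
      hqm ((Literature.NumberTheory.NumberFields.intCast_mem_asIdeal_iff_of_natCast_mem hq₀p v₀ hq₀v m).mp h)
    have hm1 : v₀.valuation ℚ (m : ℚ) = 1 := by
      have h := (HeightOneSpectrum.valuation_eq_one_iff_notMem (K := ℚ) (v := v₀) (r := ((m : ℤ) : 𝓞 ℚ))).mpr hmv
      rwa [map_intCast] at h
    rw [hm, Int.cast_mul, Int.cast_natCast, map_mul, GenusKolyTwistRamified.valuation_natCast_eq_exp_neg_one_of_mem v₀ hq₀p hq₀v,
      hm1, mul_one]
  -- `#W(ℚ_{v₀})[2] = 2`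
  have htors : Nat.card (nsmulAddMonoidHom 2 :
      (W.baseChange (v₀.adicCompletion ℚ)).toAffine.Point →+ _).ker = 2 :=
    natCard_ker_nsmul_adicCompletion_two_eq_two_of_jacobiSym W hq₀2 hgood₀ hqΔ hjac hq₀v
  -- the menus
  have hfin := fun v (hv : v ≠ v₀) => door_place_menu₅ W hadm hC v fun hdv =>
    natCard_twoTorsion_eq_one_of_minimal W hadm ht hs hq₀p hq₀d hjac (v := v) (by rw [← hv₀']; exact hv) hdv
  have hinf := GenusKolyTwistLocal.twist_place_menu_infinite_rat W hΔ hd0 hC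
  have h := GenusKolyTwistLocal.natCard_selmerGroup_twist_directed_of_menu₅_frame W Wd hd0 hC v₀ h2v₀ hv₀W hram htors hfin hinf
  -- the direction: strict is excluded by `#Sel₂(Wd) ≤ 2`
  have hcard : Nat.card (selmerGroup Wd 2) = 1 := by
    by_cases hns : ∃ c ∈ (W.kummerSelmerStructure ((2 : ℕ) : ℤ)).selmerGroup,
        galoisCohomology.localization (W.torsionGaloisModule ((2 : ℕ) : ℤ)) (Sum.inr v₀) 1 c ≠ 0
    · have h2 := h.2 hns
      change Nat.card (selmerGroup Wd 2) * 2 = Nat.card (selmerGroup W 2) at h2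
      omega
    · push Not at hns
      have h1 := h.1 hns
      change Nat.card (selmerGroup Wd 2) = Nat.card (selmerGroup W 2) * 2 at h1
      omega
  exact AddSubgroup.eq_bot_of_card_eq (selmerGroup Wd 2) hcard

/-- **`Sel₂(Wd/ℚ) = 0` at a minimal door with `Δ_W > 0`, WITHOUT Cassels–Tate.**  `W/ℚ` globally minimal elliptic with `Δ_W > 0`, `d`
door-admissible with `t(W, d) = s(W, d) = 0`, `Wd = C • W^{(d)}` elliptic, `#Sel₂(W/ℚ) = 2` and `#Sel₂(Wd/ℚ) ≤ 2`: then `Sel₂(Wd/ℚ) = ⊥`.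
The one `T`-place is the real place (`Δ_W > 0`, `d < 0` not a real square); every finite place is on the five-row menu (`door_place_menu₅`
with `natCard_twoTorsion_eq_one_of_descMinimal`); then `GenusKolyArch.natCard_selmerGroup_twist_shift_of_menu₅_inl` (Mazur–Rubin Cor. 3.4 (i) with
`T = {∞}`, the dichotomy, unconditional): `#Sel₂(Wd) = 4` is excluded, so `2·#Sel₂(Wd) = 2`.
[cite: MazurRubin2010, Prop. 3.3 and Cor. 3.4 (i)] [cite: Kramer1981, Prop. 6 and Thm. 1] [cite: GrossLMS1991, §10] -/
theorem selmerGroup_twin_eq_bot_of_pos {d : ℤ} (hadm : DoorAdmissible W d) (hΔ : 0 < W.Δ)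
    (ht : transpCount W d = 0) (hs : identCount W d = 0)
    (Wd : WeierstrassCurve ℚ) [Wd.IsElliptic] {C : VariableChange ℚ} (hC : C • W.quadraticTwist (d : ℚ) = Wd)
    (hW2 : Nat.card (selmerGroup W 2) = 2) (hWd2 : Nat.card (selmerGroup Wd 2) ≤ 2) :
    selmerGroup Wd 2 = ⊥ := by
  have hdneg : d < 0 := hadm.1
  have hd0 : (d : ℚ) ≠ 0 := by exact_mod_cast hdneg.ne
  have hw₀ : (Rat.infinitePlace).IsReal := Rat.isReal_infinitePlace
  have hΔ' : 0 < InfinitePlace.embedding_of_isReal hw₀ W.Δ := by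
    rwa [GenusKolyArch.embedding_of_isReal_rat_apply, Rat.cast_pos]
  have hinf : ∀ w : InfinitePlace ℚ, w ≠ Rat.infinitePlace →
      (∃ s : w.Completion, s ^ 2 = algebraMap ℚ w.Completion (d : ℚ)) ∨
      ((∀ x : galoisCohomology (W.localGaloisModule w.Completion) 1, x = 0) ∧
        (∀ x : galoisCohomology (Wd.localGaloisModule w.Completion) 1, x = 0)) :=
    fun w hw => absurd (Subsingleton.elim w _) hw
  have hfin := fun v => door_place_menu₅ W hadm hC v fun hdv => natCard_twoTorsion_eq_one_of_descMinimal W hadm ht hs hdv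
  have h := GenusKolyArch.natCard_selmerGroup_twist_shift_of_menu₅_inl W hd0 hC hw₀ hΔ'
    (GenusKolyArch.forall_sq_ne_completion_of_neg (by exact_mod_cast hdneg) _) hfin hinf
  have hcard : Nat.card (selmerGroup Wd 2) = 1 := by
    rcases h with h | h
    · change Nat.card (selmerGroup Wd 2) * 2 = Nat.card (selmerGroup W 2) at h
      omega
    · change Nat.card (selmerGroup Wd 2) = Nat.card (selmerGroup W 2) * 2 at h
      omega
  exact AddSubgroup.eq_bot_of_card_eq (selmerGroup Wd 2) hcard

/-- **`Sel₂(Wd/ℚ) = 0` at every MINIMAL door (`t + 2s = [Δ_W < 0]`), sign-free, WITHOUT Cassels–Tate** — from `#Sel₂(W/ℚ) = 2` and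
`#Sel₂(Wd/ℚ) ≤ 2` (the two engine outputs) by the sign split `selmerGroup_twin_eq_bot_of_neg` / `selmerGroup_twin_eq_bot_of_pos`.
[cite: MazurRubin2010, Cor. 3.4 (i)] [cite: Kramer1981, Props. 3, 6] -/
theorem selmerGroup_twin_eq_bot_of_minimal {d : ℤ} (hadm : DoorAdmissible W d)
    (hmin : transpCount W d + 2 * identCount W d = (if W.Δ < 0 then 1 else 0))
    (Wd : WeierstrassCurve ℚ) [Wd.IsElliptic] {C : VariableChange ℚ} (hC : C • W.quadraticTwist (d : ℚ) = Wd)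
    (hW2 : Nat.card (selmerGroup W 2) = 2) (hWd2 : Nat.card (selmerGroup Wd 2) ≤ 2) :
    selmerGroup Wd 2 = ⊥ := by
  rcases lt_or_gt_of_ne W.isUnit_Δ.ne_zero with hΔ | hΔ
  · obtain ⟨ht, hs⟩ := (minimal_iff_of_neg W _ hΔ).mp hmin
    exact selmerGroup_twin_eq_bot_of_neg W hadm hΔ ht hs Wd hC hW2 hWd2
  · rw [if_neg (not_lt.mpr hΔ.le)] at hmin
    exact selmerGroup_twin_eq_bot_of_pos W hadm hΔ (by omega) (by omega) Wd hC hW2 hWd2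

end Twin

/-! ### §4 The frame without Cassels–Tate -/

/-- **`#Sel₂(W/ℚ) = 2` and `#Sel₂(Wd/ℚ) ≤ 2` from a first-descent input, NO parity input** (E-side `card_sel_eq_two`; twin side
`card_twinSel_le_two₂`, instantiated exactly as in `card_selmerTwo_eq_of_input`). [cite: GrossLMS1991, Prop. 2.3 and §10] [cite: Kolyvagin1989Izv, §3] -/
theorem card_selmerTwo_of_input_ctFree (W Wd : WeierstrassCurve ℚ) (I : FirstDescentInput W Wd) :
    Nat.card (selmerGroup W 2) = 2 ∧ Nat.card (selmerGroup Wd 2) ≤ 2 := by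
  refine ⟨?_, ?_⟩
  · exact card_sel_eq_two (locAt W 2) I.q₀ (strictAt W 2 I.q₀) I.Kol I.pl (fun ℓ => strictAt W 2 (I.pl ℓ)) I.y I.c₁
      I.c₁_loc I.c₁_loc_iff I.rec₁ I.ceb₂ I.ceb₁ I.line₁ (selmerGroup W 2) (mem_selmerGroup_iff_forall_locAt W 2) I.y_mem I.y_ne
  · exact card_twinSel_le_two₂ (locAt Wd 2) I.q₀ (strictAt Wd 2 I.q₀) I.Kol I.pl (fun ℓ => strictAt W 2 (I.pl ℓ))
      (fun ℓ => strictAt Wd 2 (I.pl ℓ)) I.y I.c₂ I.c₂_loc I.c₂_loc_iff I.rec₂ I.ceb₂' I.line₂ (selmerGroup Wd 2)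
      (mem_selmerGroup_iff_forall_locAt Wd 2)

/-- **`#Sel₂(W/ℚ) = 2 ∧ Sel₂(Wd/ℚ) = ⊥` at a minimal door from a first-descent input, WITHOUT Cassels–Tate** — the conclusion of the
lead's `card_selmerTwo_eq_of_input` with its parity hypothesis `heven` replaced by the door data (`DoorAdmissible`, `t + 2s = [Δ_W < 0]`,
`Wd = Cd • W^{(d)}`): `selmerGroup_twin_eq_bot_of_minimal`. [cite: GrossLMS1991, §10] [cite: MazurRubin2010, Cor. 3.4 (i)] -/
theorem card_selmerTwo_eq_of_input_ctFree (W : WeierstrassCurve ℚ) [W.IsElliptic] [W.IsGloballyMinimal] {d : ℤ}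
    (hadm : DoorAdmissible W d) (hmin : transpCount W d + 2 * identCount W d = (if W.Δ < 0 then 1 else 0))
    (Wd : WeierstrassCurve ℚ) [Wd.IsElliptic] {C : VariableChange ℚ} (hC : C • W.quadraticTwist (d : ℚ) = Wd)
    (I : FirstDescentInput W Wd) :
    Nat.card (selmerGroup W 2) = 2 ∧ selmerGroup Wd 2 = ⊥ := by
  obtain ⟨hW2, hWd2⟩ := card_selmerTwo_of_input_ctFree W Wd I
  exact ⟨hW2, selmerGroup_twin_eq_bot_of_minimal W hadm hmin Wd hC hW2 hWd2⟩

/-- **U₀ `DoorIndexLawUpperCAtTwoBottom` FROM THE LEAVES, WITHOUT CASSELS–TATE**: the lead's `doorIndexLawUpperCAtTwoBottom_of_leaves` with the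
binder `hCT : exists_casselsTate_pairing` DELETED — `FirstDescentLeavesAtTwoBottom` (the input exists at every bottom-rung datum) and the four
primary printed facts (Gross–Zagier, Kolyvagin, modularity as a newform, Hoffstein–Luo: `rank W(ℚ) = 1` and the readout
`doorIndexLawUpperCAtTwoBottom_of_selmerTwo`) give the bottom rung; the twin count `#Sel₂(Wd/ℚ) ≤ 1` is `card_selmerTwo_eq_of_input_ctFree`
(Mazur–Rubin Cor. 3.4 (i) directed at the door's error place instead of the parity of `dim Sel₂(Wd/ℚ)`).  Conditional by design (named printed
facts as hypotheses); BSD is not proved by this. [cite: GrossLMS1991, Props. 2.3, 6.2 and §10] [cite: Kolyvagin1990, Thm. A]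
[cite: MazurRubin2010, Cor. 3.4 (i)] -/
theorem doorIndexLawUpperCAtTwoBottom_of_leaves_ctFree
    (hGZ : ∀ (N : ℕ) [NeZero N] (W : WeierstrassCurve ℚ) (K : Type) [Field K] [NumberField K], gross_zagier N W K)
    (hKo : ∀ (N : ℕ) [NeZero N] (W : WeierstrassCurve ℚ) (K : Type) [Field K] [NumberField K], kolyvagin N W K)
    (hnf : exists_isNewformOf) (hHL : HoffsteinLuo1997_exists_twist_L_one_ne_zero)
    (hL : FirstDescentLeavesAtTwoBottom) :
    DoorIndexLawUpperCAtTwoBottom := by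
  refine doorIndexLawUpperCAtTwoBottom_of_selmerTwo hGZ hKo hnf hHL ?_
  intro W _ _ _ hCM hsurj hT hc hr K _ _ hK hadm hLt Dt H ι P hP Wd _ _ Cd hWd hmin hodd hm
  obtain ⟨I⟩ := hL W hCM hsurj hT hc hr K hK hadm hLt Dt H ι P hP Wd Cd hWd hmin hodd hm
  obtain ⟨hW2, hbot⟩ := card_selmerTwo_eq_of_input_ctFree W hadm hmin Wd hWd I
  refine ⟨hW2.le, ?_⟩
  rw [hbot, AddSubgroup.card_bot]

/-- **U₀⁻ `DoorIndexLawUpperCAtTwoBottomNeg` from the leaves, WITHOUT Cassels–Tate** (the `Δ_W < 0` corner, by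
`doorIndexLawUpperCAtTwoBottomNeg_of_bottom`). [cite: GrossLMS1991, §10] [cite: Kolyvagin1990, Thm. A] -/
theorem doorIndexLawUpperCAtTwoBottomNeg_of_leaves_ctFree
    (hGZ : ∀ (N : ℕ) [NeZero N] (W : WeierstrassCurve ℚ) (K : Type) [Field K] [NumberField K], gross_zagier N W K)
    (hKo : ∀ (N : ℕ) [NeZero N] (W : WeierstrassCurve ℚ) (K : Type) [Field K] [NumberField K], kolyvagin N W K)
    (hnf : exists_isNewformOf) (hHL : HoffsteinLuo1997_exists_twist_L_one_ne_zero)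
    (hL : FirstDescentLeavesAtTwoBottom) :
    DoorIndexLawUpperCAtTwoBottomNeg :=
  doorIndexLawUpperCAtTwoBottomNeg_of_bottom (doorIndexLawUpperCAtTwoBottom_of_leaves_ctFree hGZ hKo hnf hHL hL)

end Summit.BirchSwinnertonDyer.BirchSwinnertonDyer.Theorems.RankOneAtTwoOneDoor

end
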